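import Literature.MathematicalPhysics.QuantumFieldTheory.Balaban1983to89.HaarAnalyticZeroSetNull
import Literature.MathematicalPhysics.QuantumFieldTheory.Balaban1983to89.HaarDensitySymplecticGlobal
import Literature.LinearAlgebra.Matrix.SpecialOrthogonalGroupEvenConjugacyClasses
import Literature.LinearAlgebra.Matrix.SpecialOrthogonalGroupOddConjugacyClasses

/-!
# `Balaban1983to89.HaarRegularElementsClassical` — [BrockerTomDieck1985] IV (2.11)(ii) «ALMOST EVERY ELEMENT IS
# GENERAL» FOR THE REMAINING CLASSICAL SERIES `SO(2n)`, `SO(2n+1)`, `Sp(n)`: the elements with a repeated eigenvalue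
# form a Haar-null set

statement-level skeleton of published theorems with citation tags; proofs where landed; nothing here is a claim
about the Yang–Mills mass gap

Mega-formalization `lit-balaban` (HOME `run/shared/lean/pub/lit-balaban/`), unit `lit-balaban-p28` gen 16 (Phase-2
proof seat; free-target protocol G.5-34(d), TAKING 2026-08-23T11:03Z).  File 7 (rider to file 6
`HaarAnalyticZeroSetNull`).  Gen 14's `HaarRegularElementsNull` gave (2.11)(ii) for `U(N)` and `SU(N)`; file 6 reduced
it, for every closed `G ≤ U(N)` with `Θ_G` onto, to the existence of ONE element of `G` with simple spectrum
(`haar_setOf_not_separable_charpoly_eq_zero`).  THIS FILE exhibits that element for the standard tori of [BtD] IV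
(3.4)–(3.8) — the block rotation `T(cos a, sin a) ∈ T(n) ⊂ SO(2n)`, `T(cos a, sin a) ⊕ 1 ⊂ SO(2n+1)` and
`diag(e^{ia}, e^{−ia}) ∈ Tⁿ ⊂ Sp(n)` with DISTINCT angles `a_j ∈ (0, π)` (eigenvalues `e^{±ia_j}` (and `1`), pairwise
distinct) — and concludes (2.11)(ii) for `SO(2n) = specialOrthogonalSubgroup (ι ⊕ ι)`, `SO(2n+1) =
specialOrthogonalSubgroup ((ι ⊕ ι) ⊕ Unit)` and `Sp(n) = symplecticSubgroup (Matrix.J ι ℂ)` (gen 12's realisations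
inside `U(N)`; connectedness and `Θ` onto from files 4–5).  SKELETON rows served (SUPPORT cells only, no head change):
B10.Eq21 / E18 (owner r07), B13.Eq1.37 (r10), B12.Eq2.10–2.12 (r09/r20).

CITATION HEADER.  [BrockerTomDieck1985] Ch. IV **Theorem (2.11)(ii)** *«Almost every element of G is general»*;
(3.4)–(3.6) (the standard maximal tori `T(n) ⊂ SO(2n)`, `SO(2n+1)`, eigenvalues `e^{±iϑ_ν}` of the rotation blocks —
the tree's `rotationBlocks`, `rotationBlocksOdd`, `torusEig`, `torusEigOdd`, `charpoly_cU`, `charpoly_cUOdd`), (3.7)–(3.8)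
(`Tⁿ ⊂ Sp(n)`, weights `(z, z̄)` — the tree's `spWeight`, `spTorusElt`).  [Mityagin2015] Prop. 1 (via file 6).

WHAT IS PROVED (theorems only; 0 definitions, 0 named facts, 0 sorry; axioms standard).
* §1 `torusEig_injective_of_angles` ∕ `torusEigOdd_injective_of_angles`: for injective `a : ι → (0, π)` the
  eigenvalue families `(cos a_j ± i sin a_j)` (resp. with `1` adjoined) are injective (such an `a` exists on
  every finite `ι`: `a_j = π(j+1)/(n+2)` along an enumeration).
* §2 **`exists_specialOrthogonal_even_charpoly_separable`**, **`haar_specialOrthogonal_even_setOf_not_separable_eq_zero`**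
  ∕ `ae_separable_charpoly_specialOrthogonal_even` (`SO(2n)`); §3 the same for `SO(2n+1)`; §4 the same for `Sp(n)`
  (`exists_symplectic_charpoly_separable`, **`haar_symplectic_setOf_not_separable_eq_zero`**,
  `ae_separable_charpoly_symplectic`).

HONEST SCOPE.  (i) Index types `ι ⊕ ι`, `(ι ⊕ ι) ⊕ Unit` (as in the tree's torus files), not an arbitrary `Fintype`
of even/odd cardinality (transport along `reindex` is routine but not done).  (ii) Simple-spectrum reading of
«general» only, as in gen 14 and file 6.  (iii) Nothing of files 1–6, gen 14 or the tree's torus files is re-proved.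
Failed printed steps: none (HOME/GAPS.md unchanged).
-/

noncomputable section

open NormedSpace Set Function Filter Topology MeasureTheory Complex Polynomial Matrix
open scoped ENNReal NNReal Matrix.Norms.L2Operator

namespace Literature.MathematicalPhysics.QuantumFieldTheory.Balaban1983to89.HaarRegularElementsClassical

open HaarExponentialChart HaarExponentialChart.IsChartRep
open HaarDensityOrthogonalChart (specialOrthogonalSubgroup isClosed_specialOrthogonalSubgroup)
open HaarDensitySymplecticChart (symplecticSubgroup isClosed_symplecticSubgroup)
open LogChartClosedSubgroup (unitarySubgroupLogChart)
open HaarAnalyticZeroSetNull (haar_setOf_not_separable_charpoly_eq_zero)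
open HaarDensityOrthogonalGlobal (map_ofReal_mem_unitaryGroup range_ofRealUnitary_eq
  expChart_specialOrthogonal_surjective)
open HaarDensitySymplecticGlobal (expChart_symplectic_surjective)
open SymplecticLogChartTwinBridge (mem_symplecticSubgroup_J_iff)
open Literature.LinearAlgebra.Matrix (rotationBlocks rotationBlocksOdd torusEig torusEigOdd cU cUOdd charpoly_cU
  charpoly_cUOdd cU_rotationBlocks cUOdd_rotationBlocksOdd rotationBlocks_mem_specialOrthogonalGroup
  rotationBlocksOdd_mem_specialOrthogonalGroup torusEig_inl torusEig_inr torusEigOdd_inl torusEigOdd_inr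
  compactSymplecticGroup mem_compactSymplecticGroup_iff spWeight spWeight_inl spWeight_inr spTorusElt coe_spTorusElt)

variable {ι : Type*} [Fintype ι] [DecidableEq ι]

/-! ## §1 Distinct angles in `(0, π)` give distinct eigenvalues -/

section Angles

/-- The real part of `cos a ± i sin a` is `cos a`. [folklore] -/
private theorem re_cos_add_sin_mul_I (x y : ℝ) : ((x : ℂ) + (y : ℂ) * I).re = x ∧ ((x : ℂ) - (y : ℂ) * I).re = x := by
  constructor <;> simp

/-- The imaginary parts of `cos a ± i sin a` are `± sin a`. [folklore] -/
private theorem im_cos_add_sin_mul_I (x y : ℝ) : ((x : ℂ) + (y : ℂ) * I).im = y ∧ ((x : ℂ) - (y : ℂ) * I).im = -y := by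
  constructor <;> simp

omit [Fintype ι] [DecidableEq ι] in
/-- `cos` separates distinct angles of `(0, π)`. [folklore] -/
private theorem eq_of_cos_eq {a : ι → ℝ} (ha : Function.Injective a) (h0 : ∀ j, 0 < a j) (hπ : ∀ j, a j < Real.pi)
    {j k : ι} (h : Real.cos (a j) = Real.cos (a k)) : j = k :=
  ha (Real.injOn_cos ⟨(h0 j).le, (hπ j).le⟩ ⟨(h0 k).le, (hπ k).le⟩ h)

omit [Fintype ι] [DecidableEq ι] in
/-- **Distinct angles `a_j ∈ (0, π)` give pairwise distinct eigenvalues `e^{±ia_j}`** of the block rotation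
`T(cos a, sin a)` ([BtD] IV (3.6): the eigenvalue family `torusEig`). [cite: BrockerTomDieck1985, IV (3.6), (2.11)] -/
theorem torusEig_injective_of_angles {a : ι → ℝ} (ha : Function.Injective a) (h0 : ∀ j, 0 < a j)
    (hπ : ∀ j, a j < Real.pi) :
    Function.Injective (torusEig (fun j => Real.cos (a j)) (fun j => Real.sin (a j))) := by
  have hsin : ∀ j, 0 < Real.sin (a j) := fun j => Real.sin_pos_of_pos_of_lt_pi (h0 j) (hπ j)
  intro b b' h
  cases b with
  | inl j =>
    cases b' with
    | inl k =>
      have hre := congrArg Complex.re h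
      rw [torusEig_inl, torusEig_inl, (re_cos_add_sin_mul_I _ _).1, (re_cos_add_sin_mul_I _ _).1] at hre
      rw [eq_of_cos_eq ha h0 hπ hre]
    | inr k =>
      have him := congrArg Complex.im h
      rw [torusEig_inl, torusEig_inr, (im_cos_add_sin_mul_I _ _).1, (im_cos_add_sin_mul_I _ _).2] at him
      linarith [hsin j, hsin k]
  | inr j =>
    cases b' with
    | inl k =>
      have him := congrArg Complex.im h
      rw [torusEig_inr, torusEig_inl, (im_cos_add_sin_mul_I _ _).2, (im_cos_add_sin_mul_I _ _).1] at him
      linarith [hsin j, hsin k]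
    | inr k =>
      have hre := congrArg Complex.re h
      rw [torusEig_inr, torusEig_inr, (re_cos_add_sin_mul_I _ _).2, (re_cos_add_sin_mul_I _ _).2] at hre
      rw [eq_of_cos_eq ha h0 hπ hre]

omit [Fintype ι] [DecidableEq ι] in
/-- The same with the eigenvalue `1` of the axis adjoined (`SO(2n+1)`, [BtD] IV (3.6): `torusEigOdd`): `e^{±ia_j} ≠ 1`
since `sin a_j ≠ 0`. [cite: BrockerTomDieck1985, IV (3.6), (2.11)] -/
theorem torusEigOdd_injective_of_angles {a : ι → ℝ} (ha : Function.Injective a) (h0 : ∀ j, 0 < a j)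
    (hπ : ∀ j, a j < Real.pi) :
    Function.Injective (torusEigOdd (fun j => Real.cos (a j)) (fun j => Real.sin (a j))) := by
  have hsin : ∀ j, 0 < Real.sin (a j) := fun j => Real.sin_pos_of_pos_of_lt_pi (h0 j) (hπ j)
  have him1 : ∀ b : ι ⊕ ι, (torusEig (fun j => Real.cos (a j)) (fun j => Real.sin (a j)) b).im ≠ 0 := by
    intro b
    cases b with
    | inl j => rw [torusEig_inl, (im_cos_add_sin_mul_I _ _).1]; exact (hsin j).ne'
    | inr j => rw [torusEig_inr, (im_cos_add_sin_mul_I _ _).2]; exact neg_ne_zero.2 (hsin j).ne'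
  intro b b' h
  cases b with
  | inl c =>
    cases b' with
    | inl c' =>
      rw [torusEigOdd_inl, torusEigOdd_inl] at h
      rw [torusEig_injective_of_angles ha h0 hπ h]
    | inr u =>
      rw [torusEigOdd_inl, torusEigOdd_inr] at h
      exact absurd (by rw [h, Complex.one_im]) (him1 c)
  | inr u =>
    cases b' with
    | inl c' =>
      rw [torusEigOdd_inr, torusEigOdd_inl] at h
      exact absurd (by rw [← h, Complex.one_im]) (him1 c')
    | inr u' => rw [Subsingleton.elim u u']

omit [DecidableEq ι] in
/-- On every finite index set there are pairwise distinct angles in `(0, π)` (`a_j = π(j+1)/(n+2)` along an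
enumeration). [folklore] -/
private theorem exists_angles : ∃ a : ι → ℝ, Function.Injective a ∧ (∀ j, 0 < a j) ∧ ∀ j, a j < Real.pi := by
  set e := Fintype.equivFin ι with he
  refine ⟨fun j => Real.pi * (((e j : ℕ) : ℝ) + 1) / ((Fintype.card ι : ℝ) + 2), ?_, ?_, ?_⟩
  · intro j k hjk
    have hN : (0 : ℝ) < (Fintype.card ι : ℝ) + 2 := by positivity
    have h1 : (((e j : ℕ) : ℝ) + 1) = (((e k : ℕ) : ℝ) + 1) := by
      have h2 := congrArg (fun x : ℝ => x * ((Fintype.card ι : ℝ) + 2) / Real.pi) hjk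
      simp only at h2
      rwa [div_mul_cancel₀ _ hN.ne', div_mul_cancel₀ _ hN.ne', mul_div_cancel_left₀ _ Real.pi_pos.ne',
        mul_div_cancel_left₀ _ Real.pi_pos.ne'] at h2
    have h3 : (e j : ℕ) = (e k : ℕ) := by exact_mod_cast add_right_cancel h1
    exact e.injective (Fin.ext h3)
  · intro j; positivity
  · intro j
    have hN : (0 : ℝ) < (Fintype.card ι : ℝ) + 2 := by positivity
    rw [div_lt_iff₀ hN]
    have h4 : ((e j : ℕ) : ℝ) < (Fintype.card ι : ℝ) := by exact_mod_cast (e j).2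
    exact mul_lt_mul_of_pos_left (by linarith) Real.pi_pos

end Angles

/-! ## §2 `SO(2n)` -/

section Even

/-- **A rotation with simple spectrum in `SO(2n) ≤ U(2n)`**: the complexified block rotation `T(cos a, sin a)` with
distinct `a_j ∈ (0, π)` has separable characteristic polynomial `Π_b (X − e^{±ia_j})` ([BtD] IV (3.6), the tree's
`charpoly_cU`, `cU_rotationBlocks`). [cite: BrockerTomDieck1985, IV (3.4), (3.6), (2.11)] -/
theorem exists_specialOrthogonal_even_charpoly_separable :
    ∃ g₀ : specialOrthogonalSubgroup (ι ⊕ ι),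
      (((g₀ : specialOrthogonalSubgroup (ι ⊕ ι)) : Matrix.unitaryGroup (ι ⊕ ι) ℂ) :
        Matrix (ι ⊕ ι) (ι ⊕ ι) ℂ).charpoly.Separable := by
  obtain ⟨a, ha, h0, hπ⟩ := exists_angles (ι := ι)
  set c : ι → ℝ := fun j => Real.cos (a j) with hc
  set s : ι → ℝ := fun j => Real.sin (a j) with hs
  have hcs : ∀ j, c j ^ 2 + s j ^ 2 = 1 := fun j => Real.cos_sq_add_sin_sq (a j)
  have hR : rotationBlocks c s ∈ Matrix.specialOrthogonalGroup (ι ⊕ ι) ℝ := rotationBlocks_mem_specialOrthogonalGroup hcs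
  set u : Matrix.unitaryGroup (ι ⊕ ι) ℂ := ⟨(rotationBlocks c s).map ((↑) : ℝ → ℂ), map_ofReal_mem_unitaryGroup hR⟩
    with hu
  have hmem : u ∈ specialOrthogonalSubgroup (ι ⊕ ι) := by
    have : u ∈ Set.range (fun A : (Matrix.specialOrthogonalGroup (ι ⊕ ι) ℝ : Set (Matrix (ι ⊕ ι) (ι ⊕ ι) ℝ)) =>
        (⟨(A : Matrix (ι ⊕ ι) (ι ⊕ ι) ℝ).map ((↑) : ℝ → ℂ), map_ofReal_mem_unitaryGroup A.2⟩ :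
          Matrix.unitaryGroup (ι ⊕ ι) ℂ)) := ⟨⟨rotationBlocks c s, hR⟩, rfl⟩
    rw [range_ofRealUnitary_eq] at this
    exact this
  refine ⟨⟨u, hmem⟩, ?_⟩
  show ((rotationBlocks c s).map ((↑) : ℝ → ℂ)).charpoly.Separable
  rw [← charpoly_cU, cU_rotationBlocks, Matrix.charpoly_diagonal]
  exact Polynomial.separable_prod_X_sub_C_iff.2 (torusEig_injective_of_angles ha h0 hπ)

/-- **[BtD] IV (2.11)(ii) FOR `SO(2n)`**: for every Haar measure `μ` on `SO(2n) ≤ U(2n)` the rotations with a repeated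
eigenvalue form a `μ`-null set (file 6 with the element of `exists_specialOrthogonal_even_charpoly_separable`; `SO(2n)`
connected, `Θ` onto — file 4). [cite: BrockerTomDieck1985, IV (2.11)] [cite: Mityagin2015, Proposition 1] -/
theorem haar_specialOrthogonal_even_setOf_not_separable_eq_zero (μ : Measure (specialOrthogonalSubgroup (ι ⊕ ι)))
    [μ.IsHaarMeasure] :
    μ {g : specialOrthogonalSubgroup (ι ⊕ ι) |
      ¬ (((g : specialOrthogonalSubgroup (ι ⊕ ι)) : Matrix.unitaryGroup (ι ⊕ ι) ℂ) :
        Matrix (ι ⊕ ι) (ι ⊕ ι) ℂ).charpoly.Separable} = 0 :=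
  haar_setOf_not_separable_charpoly_eq_zero _ _ μ expChart_specialOrthogonal_surjective
    exists_specialOrthogonal_even_charpoly_separable

/-- Almost every rotation in `SO(2n)` has simple spectrum. [cite: BrockerTomDieck1985, IV (2.11)] -/
theorem ae_separable_charpoly_specialOrthogonal_even (μ : Measure (specialOrthogonalSubgroup (ι ⊕ ι)))
    [μ.IsHaarMeasure] :
    ∀ᵐ g ∂μ, (((g : specialOrthogonalSubgroup (ι ⊕ ι)) : Matrix.unitaryGroup (ι ⊕ ι) ℂ) :
      Matrix (ι ⊕ ι) (ι ⊕ ι) ℂ).charpoly.Separable := by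
  rw [ae_iff]
  exact haar_specialOrthogonal_even_setOf_not_separable_eq_zero μ

end Even

/-! ## §3 `SO(2n+1)` -/

section Odd

/-- **A rotation with simple spectrum in `SO(2n+1) ≤ U(2n+1)`**: `T(cos a, sin a) ⊕ 1` with distinct `a_j ∈ (0, π)`
(eigenvalues `e^{±ia_j}`, `1`; the tree's `charpoly_cUOdd`, `cUOdd_rotationBlocksOdd`).
[cite: BrockerTomDieck1985, IV (3.4), (3.6), (2.11)] -/
theorem exists_specialOrthogonal_odd_charpoly_separable :
    ∃ g₀ : specialOrthogonalSubgroup ((ι ⊕ ι) ⊕ Unit),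
      (((g₀ : specialOrthogonalSubgroup ((ι ⊕ ι) ⊕ Unit)) : Matrix.unitaryGroup ((ι ⊕ ι) ⊕ Unit) ℂ) :
        Matrix ((ι ⊕ ι) ⊕ Unit) ((ι ⊕ ι) ⊕ Unit) ℂ).charpoly.Separable := by
  obtain ⟨a, ha, h0, hπ⟩ := exists_angles (ι := ι)
  set c : ι → ℝ := fun j => Real.cos (a j) with hc
  set s : ι → ℝ := fun j => Real.sin (a j) with hs
  have hcs : ∀ j, c j ^ 2 + s j ^ 2 = 1 := fun j => Real.cos_sq_add_sin_sq (a j)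
  have hR : rotationBlocksOdd c s ∈ Matrix.specialOrthogonalGroup ((ι ⊕ ι) ⊕ Unit) ℝ :=
    rotationBlocksOdd_mem_specialOrthogonalGroup hcs
  set u : Matrix.unitaryGroup ((ι ⊕ ι) ⊕ Unit) ℂ :=
    ⟨(rotationBlocksOdd c s).map ((↑) : ℝ → ℂ), map_ofReal_mem_unitaryGroup hR⟩ with hu
  have hmem : u ∈ specialOrthogonalSubgroup ((ι ⊕ ι) ⊕ Unit) := by
    have : u ∈ Set.range
        (fun A : (Matrix.specialOrthogonalGroup ((ι ⊕ ι) ⊕ Unit) ℝ : Set (Matrix ((ι ⊕ ι) ⊕ Unit) ((ι ⊕ ι) ⊕ Unit) ℝ)) =>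
          (⟨(A : Matrix ((ι ⊕ ι) ⊕ Unit) ((ι ⊕ ι) ⊕ Unit) ℝ).map ((↑) : ℝ → ℂ), map_ofReal_mem_unitaryGroup A.2⟩ :
            Matrix.unitaryGroup ((ι ⊕ ι) ⊕ Unit) ℂ)) := ⟨⟨rotationBlocksOdd c s, hR⟩, rfl⟩
    rw [range_ofRealUnitary_eq] at this
    exact this
  refine ⟨⟨u, hmem⟩, ?_⟩
  show ((rotationBlocksOdd c s).map ((↑) : ℝ → ℂ)).charpoly.Separable
  rw [← charpoly_cUOdd, cUOdd_rotationBlocksOdd, Matrix.charpoly_diagonal]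
  exact Polynomial.separable_prod_X_sub_C_iff.2 (torusEigOdd_injective_of_angles ha h0 hπ)

/-- **[BtD] IV (2.11)(ii) FOR `SO(2n+1)`**: for every Haar measure `μ` on `SO(2n+1) ≤ U(2n+1)` the rotations with a
repeated eigenvalue form a `μ`-null set. [cite: BrockerTomDieck1985, IV (2.11)] [cite: Mityagin2015, Proposition 1] -/
theorem haar_specialOrthogonal_odd_setOf_not_separable_eq_zero
    (μ : Measure (specialOrthogonalSubgroup ((ι ⊕ ι) ⊕ Unit))) [μ.IsHaarMeasure] :
    μ {g : specialOrthogonalSubgroup ((ι ⊕ ι) ⊕ Unit) |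
      ¬ (((g : specialOrthogonalSubgroup ((ι ⊕ ι) ⊕ Unit)) : Matrix.unitaryGroup ((ι ⊕ ι) ⊕ Unit) ℂ) :
        Matrix ((ι ⊕ ι) ⊕ Unit) ((ι ⊕ ι) ⊕ Unit) ℂ).charpoly.Separable} = 0 :=
  haar_setOf_not_separable_charpoly_eq_zero _ _ μ expChart_specialOrthogonal_surjective
    exists_specialOrthogonal_odd_charpoly_separable

/-- Almost every rotation in `SO(2n+1)` has simple spectrum. [cite: BrockerTomDieck1985, IV (2.11)] -/
theorem ae_separable_charpoly_specialOrthogonal_odd (μ : Measure (specialOrthogonalSubgroup ((ι ⊕ ι) ⊕ Unit)))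
    [μ.IsHaarMeasure] :
    ∀ᵐ g ∂μ, (((g : specialOrthogonalSubgroup ((ι ⊕ ι) ⊕ Unit)) : Matrix.unitaryGroup ((ι ⊕ ι) ⊕ Unit) ℂ) :
      Matrix ((ι ⊕ ι) ⊕ Unit) ((ι ⊕ ι) ⊕ Unit) ℂ).charpoly.Separable := by
  rw [ae_iff]
  exact haar_specialOrthogonal_odd_setOf_not_separable_eq_zero μ

end Odd

/-! ## §4 `Sp(n)` -/

section Symplectic

omit [Fintype ι] [DecidableEq ι] in
/-- The weights `(z, z̄)` of `diag(e^{ia}, e^{−ia}) ∈ Tⁿ ⊂ Sp(n)` are the eigenvalue family of the rotation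
`T(cos a, sin a)` ([BtD] IV (3.7): «`Tⁿ` is the image of `Δ(n)`»). [cite: BrockerTomDieck1985, IV (3.7), (3.8)] -/
theorem spWeight_cos_add_sin_eq_torusEig (a : ι → ℝ) :
    spWeight (fun j => (Real.cos (a j) : ℂ) + (Real.sin (a j) : ℂ) * I) =
      torusEig (fun j => Real.cos (a j)) (fun j => Real.sin (a j)) := by
  funext b
  cases b with
  | inl j => rw [spWeight_inl, torusEig_inl]
  | inr j =>
    rw [spWeight_inr, torusEig_inr, Complex.star_def, map_add, map_mul, Complex.conj_ofReal, Complex.conj_ofReal,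
      Complex.conj_I, mul_neg, sub_eq_add_neg]

/-- **An element with simple spectrum in `Sp(n) ≤ U(2n)`**: `diag(e^{ia_j}, e^{−ia_j})` with distinct `a_j ∈ (0, π)`
(p24's `spTorusElt`, carried into gen 12's `symplecticSubgroup (Matrix.J ι ℂ)` by r20's `mem_symplecticSubgroup_J_iff`).
[cite: BrockerTomDieck1985, IV (3.7), (3.8), (2.11)] -/
theorem exists_symplectic_charpoly_separable :
    ∃ g₀ : symplecticSubgroup (Matrix.J ι ℂ),
      (((g₀ : symplecticSubgroup (Matrix.J ι ℂ)) : Matrix.unitaryGroup (ι ⊕ ι) ℂ) :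
        Matrix (ι ⊕ ι) (ι ⊕ ι) ℂ).charpoly.Separable := by
  obtain ⟨a, ha, h0, hπ⟩ := exists_angles (ι := ι)
  set d : ι → ℂ := fun j => (Real.cos (a j) : ℂ) + (Real.sin (a j) : ℂ) * I with hd
  have hd1 : ∀ j, ‖d j‖ = 1 := by
    intro j
    have h := Literature.LinearAlgebra.Matrix.norm_torusEig (c := fun j => Real.cos (a j))
      (s := fun j => Real.sin (a j)) (fun j => Real.cos_sq_add_sin_sq (a j)) (Sum.inl j)
    rwa [torusEig_inl] at h
  set X : compactSymplecticGroup ι := spTorusElt d hd1 with hX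
  set u : Matrix.unitaryGroup (ι ⊕ ι) ℂ :=
    ⟨(X : Matrix (ι ⊕ ι) (ι ⊕ ι) ℂ), (mem_compactSymplecticGroup_iff.1 X.2).1⟩ with hu
  have hmem : u ∈ symplecticSubgroup (Matrix.J ι ℂ) :=
    mem_symplecticSubgroup_J_iff.2 (mem_compactSymplecticGroup_iff.1 X.2).2
  refine ⟨⟨u, hmem⟩, ?_⟩
  show ((X : compactSymplecticGroup ι) : Matrix (ι ⊕ ι) (ι ⊕ ι) ℂ).charpoly.Separable
  rw [hX, coe_spTorusElt, Matrix.charpoly_diagonal, spWeight_cos_add_sin_eq_torusEig]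
  exact Polynomial.separable_prod_X_sub_C_iff.2 (torusEig_injective_of_angles ha h0 hπ)

/-- **[BtD] IV (2.11)(ii) FOR `Sp(n)`**: for every Haar measure `μ` on `Sp(n) ≤ U(2n)` the elements with a repeated
eigenvalue form a `μ`-null set (file 6; `Sp(n)` connected, `Θ` onto — file 5). [cite: BrockerTomDieck1985, IV (2.11)]
[cite: Mityagin2015, Proposition 1] -/
theorem haar_symplectic_setOf_not_separable_eq_zero (μ : Measure (symplecticSubgroup (Matrix.J ι ℂ)))
    [μ.IsHaarMeasure] :
    μ {g : symplecticSubgroup (Matrix.J ι ℂ) |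
      ¬ (((g : symplecticSubgroup (Matrix.J ι ℂ)) : Matrix.unitaryGroup (ι ⊕ ι) ℂ) :
        Matrix (ι ⊕ ι) (ι ⊕ ι) ℂ).charpoly.Separable} = 0 :=
  haar_setOf_not_separable_charpoly_eq_zero _ _ μ expChart_symplectic_surjective exists_symplectic_charpoly_separable

/-- Almost every element of `Sp(n)` has simple spectrum. [cite: BrockerTomDieck1985, IV (2.11)] -/
theorem ae_separable_charpoly_symplectic (μ : Measure (symplecticSubgroup (Matrix.J ι ℂ))) [μ.IsHaarMeasure] :
    ∀ᵐ g ∂μ, (((g : symplecticSubgroup (Matrix.J ι ℂ)) : Matrix.unitaryGroup (ι ⊕ ι) ℂ) :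
      Matrix (ι ⊕ ι) (ι ⊕ ι) ℂ).charpoly.Separable := by
  rw [ae_iff]
  exact haar_symplectic_setOf_not_separable_eq_zero μ

end Symplectic

end Literature.MathematicalPhysics.QuantumFieldTheory.Balaban1983to89.HaarRegularElementsClassical

end
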